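import Literature.MathematicalPhysics.StatisticalMechanics.NJLExponentialClustering
import HarnessLib

/-!
# Clustering for pairs of separated local observables at every mass off `i[-√(2ν), √(2ν)]`
# (Salmhofer–Seiler, CMP 139 (1991), Thm. 3.11 ∕ Erratum CMP 146 (1992), (7))

Salmhofer–Seiler, Erratum p. 638: "By a similar argument as given above, one can show that for all
`L, M ∈ ℒ₊`, `|⟨σ^Lσ^M⟩ - ⟨σ^L⟩⟨σ^M⟩| ≤ C(m, L, M) e^{-κ(m) d(L,M)}` (7), where `d(L, M)` is the
minimal distance between the supports of `L` and `M`, the function `B_n(m)` enters in the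
prefactor `C(m, L, M)` and `κ(m)` does not depend on `L` and `M`."  This is the form of Thm. 3.11
the Erratum's transfer-operator argument (8)–(9) consumes.

This file proves (7) for the β = 0 NJL system on the tori `(ℤ/Lℤ)^ν`, at EVERY mass of the
zero-free region `ℂ ∖ i[-√(2ν), √(2ν)]` (`njlMassRegion`), uniformly in the volume and for the
thermodynamic limits of Thm. 3.8, with ONE rate `κ(m) > 0` for all pairs of local observables
`σ^{d₁}, σ^{d₂}` (`d₁, d₂ ≤ N` pointwise) — by the road of `NJLExponentialClustering` (Joukowski
parametrisation of the slit region + Penrose–Lebowitz in Schwarz-lemma form,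
`norm_le_mul_pow_of_isBigO_cobounded`), the large-mass input being the locality of the hopping
expansion for capacity ratios (`njlCapZ_div_locality`, `NJLHoppingLocality`):

* `njl_truncatedPair_isBigO` — for `d₁` supported in the box `{|x|_∞ + n ≤ R}` and `d₂` in the shell
  `{R < |y|_∞ ≤ R'}` (torus wider than `2R'`):
  `⟨σ^{d₁}σ^{d₂}⟩_Λ - ⟨σ^{d₁}⟩_Λ⟨σ^{d₂}⟩_Λ = O(|m|^{-n})` at `m = ∞` — the capacities `N - d₂` and
  `N` agree on the box of radius `R`, so removing `d₁` costs the same to order `n` in both;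
* `njl_pair_clustering_joukowskiMass` — at `m = (√(2ν)/2)(w⁻¹ - w)`, `0 < |w| < r < 1`:
  `|…| ≤ 2A(r)^{|d₁|+|d₂|} (|w|/r)^n` in every volume (`A = njlSpinMajorant`);
* `njl_pair_clustering_of_mem` / `njl_pair_exponentialClustering` — for every `m` in the region:
  `q(m) < 1`, resp. one `κ(m) = log(r/q(m)) > 0` for ALL `d₁, d₂` and a prefactor `C(m, d₁, d₂)`
  with `|…| ≤ C e^{-κ(m) n}`, `n` = the gap between the supports, every volume;
* `njl_pair_exponentialClustering_limit` — the same for the limits along every `L_j → ∞`.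

Scope.  The separation is measured by the sup-norm gap `n` between a box around the origin
containing `supp d₁` and the shell containing `supp d₂` (`≤ d(L, M)`; by translation invariance of
the torus this is no restriction on the position of the pair, but the translation is not performed
here); the rate per unit gap is `log(r/q(m))`, half the two-point rate of `NJLExponentialClustering`
(the telescoping locality `njlCapZ_div_locality` is used at order `n ≤ R` rather than `2R + 1`).
Not formalised: the fully truncated `n`-point functions with the tree length (3.32), the Erratum's
(5)/(8)–(9) (transfer operator).  β = 0 NJL on tori only; nothing about β > 0, the continuum,
`SU(N)`, a mass gap or the summit's `QCD` conjunct.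

## References

* M. Salmhofer, E. Seiler, Erratum: *Proof of chiral symmetry breaking in strongly coupled lattice
  gauge theory*, Commun. Math. Phys. 146 (1992) 637–638: (7). [SalmhoferSeiler1992Erratum]
* M. Salmhofer, E. Seiler, Commun. Math. Phys. 139 (1991) 395–432: Thm. 3.11, Remark 3.10.
  [SalmhoferSeiler1991]
* O. Penrose, J. L. Lebowitz, Commun. Math. Phys. 39 (1974) 165–184: Lemma 5. [PenroseLebowitz1974]
-/

noncomputable section

open Filter Asymptotics Bornology Topology Metric Set

namespace Literature.MathematicalPhysics.StatisticalMechanics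

namespace ComplexSpin

open Literature.Probability.LatticeModels (TorusSite Site)
open Literature.Probability.LatticeModels

variable {ν : ℕ}

/-! ### Erratum (7): pairs of local observables with separated supports -/

section Pair

variable {L : ℕ} [NeZero L]

omit [NeZero L] in
/-- A multi-index planted at a torus point is additive in the multi-index. [folklore] -/
private theorem plant_add' (z : TorusSite ν L) (l l' : Site ν →₀ ℕ) :
    plant z (l + l') = plant z l + plant z l' := by
  simp [plant, Finsupp.mapDomain_add]

/-- Reading a multi-index on the torus through the projection is planting it at `0`. [folklore] -/
private theorem mapDomain_proj_eq_plant' (L : ℕ) (d : Site ν →₀ ℕ) :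
    Finsupp.mapDomain (Torus.proj L) d = plant (0 : TorusSite ν L) d := by
  unfold plant
  congr 1
  funext x
  rw [zero_add]

omit [NeZero L] in
/-- A point of the box of radius `R` and a point with a coordinate of modulus in `(R, R']`,
`R + R' < L`, are distinct on the torus `(ℤ/Lℤ)^ν`. [folklore] -/
private theorem proj_ne_of_far {R R' : ℕ} (hRR' : R + R' < L) {v y : Site ν} (hv : ∀ i, |v i| ≤ (R : ℤ))
    (hy : ∀ i, |y i| ≤ (R' : ℤ)) (hfar : ∃ i, (R : ℤ) < |y i|) :
    Torus.proj L y ≠ Torus.proj L v := by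
  obtain ⟨i, hi⟩ := hfar
  have h1 : (1 : ℤ) ≤ |v i - y i| := by
    have := abs_sub_abs_le_abs_sub (y i) (v i)
    rw [abs_sub_comm] at this
    have hv' := hv i
    linarith
  have h2 : |v i - y i| + ((1 : ℕ) : ℤ) ≤ L := by
    have := abs_sub (v i) (y i)
    have hv' := hv i
    have hy' := hy i
    have hRR'' : ((R : ℤ) + R') + 1 ≤ L := by exact_mod_cast hRR'
    push_cast
    linarith
  exact proj_ne_of_separated (D := 1) (by exact_mod_cast h1) h2 le_rfl

omit [NeZero L] in
/-- A multi-index supported `R`-far from the origin (inside the box `R'`, `R + R' < L`), planted at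
`0`, vanishes on the torus image of the box of radius `R`. [folklore] -/
private theorem plant_apply_eq_zero_of_far {R R' : ℕ} (hRR' : R + R' < L) {d : Site ν →₀ ℕ}
    (hbox : ∀ y ∈ d.support, ∀ i, |y i| ≤ (R' : ℤ)) (hfar : ∀ y ∈ d.support, ∃ i, (R : ℤ) < |y i|)
    {v : Site ν} (hv : ∀ i, |v i| ≤ (R : ℤ)) :
    plant (0 : TorusSite ν L) d (Torus.proj L v) = 0 := by
  classical
  rw [← Finsupp.notMem_support_iff]
  intro hmem
  have := Finsupp.mapDomain_support (f := fun x : Site ν => (0 : TorusSite ν L) + Torus.proj L x) hmem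
  rw [Finset.mem_image] at this
  obtain ⟨y, hy, hyv⟩ := this
  rw [zero_add] at hyv
  exact proj_ne_of_far hRR' hv (hbox y hy) (hfar y hy) hyv

/-- **Locality for a pair of separated local observables** (the large-mass input of the Erratum's
(7)): for multi-indices `d₁ ≤ N` supported in the box `|x|_∞ + n ≤ R` and `d₂ ≤ N` supported in
`{R < |y|_∞ ≤ R'}` (`R ≤ R'`, torus wider than `2R'`),
`⟨σ^{d₁}σ^{d₂}⟩_Λ(m) - ⟨σ^{d₁}⟩_Λ(m)⟨σ^{d₂}⟩_Λ(m) = O(|m|^{-n})` as `|m| → ∞`: the capacities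
`N - d₂` and `N` agree on the box of radius `R`, so removing `d₁` costs the same to order `n` in
both backgrounds (`njlCapZ_div_locality`). [cite: SalmhoferSeiler1992Erratum, (7)][cite: SalmhoferSeiler1991, Remark 3.10] -/
theorem njl_truncatedPair_isBigO {N : ℕ} (hN : 1 ≤ N) {d₁ d₂ : Site ν →₀ ℕ} (hd₁ : ∀ x, d₁ x ≤ N)
    (hd₂ : ∀ x, d₂ x ≤ N) {n R R' : ℕ} (hnR : n ≤ R) (hRR' : R ≤ R') (hL : 2 * R' < L)
    (hbox₁ : ∀ x ∈ d₁.support, ∀ i, |x i| + (n : ℤ) ≤ R)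
    (hbox₂ : ∀ y ∈ d₂.support, ∀ i, |y i| ≤ (R' : ℤ))
    (hfar : ∀ y ∈ d₂.support, ∃ i, (R : ℤ) < |y i|) :
    (fun m => njlCorrelation N L (d₁ + d₂) m - njlCorrelation N L d₁ m * njlCorrelation N L d₂ m)
      =O[cobounded ℂ] fun m : ℂ => (‖m‖⁻¹ ^ n : ℝ) := by
  have hRR'L : R + R' < L := by omega
  have hRL : 2 * R < L := by omega
  have hbox₁R : ∀ x ∈ d₁.support, ∀ i, |x i| ≤ (R : ℤ) := fun x hx i => by
    have := hbox₁ x hx i; have : (0 : ℤ) ≤ n := Nat.cast_nonneg n; linarith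
  have hbox₁R' : ∀ x ∈ d₁.support, ∀ i, |x i| ≤ (R' : ℤ) := fun x hx i =>
    (hbox₁R x hx i).trans (by exact_mod_cast hRR')
  -- the capacities
  set c : TorusSite ν L →₀ ℕ := topExponent (ν := ν) (L := L) N with hc
  set P₁ : TorusSite ν L →₀ ℕ := plant (0 : TorusSite ν L) d₁ with hP₁
  set P₂ : TorusSite ν L →₀ ℕ := plant (0 : TorusSite ν L) d₂ with hP₂
  have htop : ∀ x, c x ≤ N := fun x => (topExponent_apply' N x).le
  have hc₁ : ∀ x, (c - P₂) x ≤ N := fun x => by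
    rw [Finsupp.tsub_apply]; exact (Nat.sub_le _ _).trans (htop x)
  -- `P₂` vanishes on the box of radius `R`
  have hP₂box : ∀ v : Site ν, (∀ i, |v i| ≤ (R : ℤ)) → P₂ (Torus.proj L v) = 0 := fun v hv =>
    plant_apply_eq_zero_of_far hRR'L hbox₂ hfar hv
  have hA : CapAgree R (0 : TorusSite ν L) (c - P₂) (0 : TorusSite ν L) c := by
    intro v hv
    rw [zero_add, Finsupp.tsub_apply, hP₂box v hv, Nat.sub_zero]
  have hfit : ∀ x ∈ d₁.support, d₁ x ≤ (c - P₂) ((0 : TorusSite ν L) + Torus.proj L x) := by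
    intro x hx
    rw [zero_add, Finsupp.tsub_apply, hP₂box x (hbox₁R x hx), Nat.sub_zero, hc, topExponent_apply']
    exact hd₁ x
  -- supports are disjoint, so `d₁ + d₂ ≤ N` pointwise
  have hdisj : ∀ x, x ∈ d₁.support → x ∉ d₂.support := by
    intro x hx hx2
    obtain ⟨i, hi⟩ := hfar x hx2
    have := hbox₁R x hx i
    linarith
  have hd₁₂ : ∀ x, (d₁ + d₂) x ≤ N := by
    intro x
    rw [Finsupp.add_apply]
    by_cases h1 : x ∈ d₁.support
    · rw [Finsupp.notMem_support_iff.1 (hdisj x h1), add_zero]; exact hd₁ x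
    · rw [Finsupp.notMem_support_iff.1 h1, zero_add]; exact hd₂ x
  have hbox₁₂ : ∀ x ∈ (d₁ + d₂).support, ∀ i, |x i| ≤ (R' : ℤ) := by
    intro x hx i
    rcases Finset.mem_union.1 (Finsupp.support_add hx) with h | h
    · exact hbox₁R' x h i
    · exact hbox₂ x h i
  -- locality of the bracket and boundedness of the prefactor
  have hbr := njlCapZ_div_locality hN n d₁ R (0 : TorusSite ν L) (c - P₂) (0 : TorusSite ν L) c
    hc₁ htop hA hnR hRL hRL hbox₁ hfit
  have hP₂le : P₂ ≤ c := by
    intro y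
    classical
    by_cases hy : y ∈ P₂.support
    · obtain ⟨x, hx, rfl⟩ : ∃ x ∈ d₂.support, (0 : TorusSite ν L) + Torus.proj L x = y := by
        simpa [hP₂, plant] using Finsupp.mapDomain_support hy
      rw [hc, topExponent_apply', hP₂, zero_add]
      have hinj : Set.InjOn (fun x : Site ν => (0 : TorusSite ν L) + Torus.proj L x)
          {x : Site ν | ∀ i, |x i| ≤ (R' : ℤ)} := by
        intro a ha b hb hab
        simp only [zero_add] at hab
        exact torusProj_injOn_box hL ha hb hab
      rw [show Torus.proj L x = (fun x : Site ν => (0 : TorusSite ν L) + Torus.proj L x) x by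
        simp, plant, Finsupp.mapDomain_apply' {x : Site ν | ∀ i, |x i| ≤ (R' : ℤ)} d₂
        (fun y hy => by exact hbox₂ y (Finset.mem_coe.1 hy)) hinj (hbox₂ x hx)]
      exact hd₂ x
    · rw [Finsupp.notMem_support_iff.1 hy]; exact Nat.zero_le _
  have hpre := njlCapZ_div_isBigO_one hN (tsub_le_self : c - P₂ ≤ c) htop
  have hprod := (hpre.mul hbr).congr_right (g₂ := fun m : ℂ => (‖m‖⁻¹ ^ n : ℝ)) fun m => by
    rw [← pow_add, zero_add]
  refine hprod.congr' ?_ EventuallyEq.rfl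
  -- the algebraic identity, valid where the partition functions do not vanish
  have hev : ∀ᶠ m : ℂ in cobounded ℂ, Real.sqrt (2 * ν) ≤ ‖m‖ ∧ 1 ≤ ‖m‖ := by
    have h := (tendsto_norm_cobounded_atTop (E := ℂ)).eventually
      (eventually_ge_atTop (max (Real.sqrt (2 * ν)) 1))
    exact h.mono fun m hm => ⟨(le_max_left _ _).trans hm, (le_max_right _ _).trans hm⟩
  filter_upwards [hev] with m hm
  have hm0 : m ≠ 0 := by
    intro h0; rw [h0, norm_zero] at hm; linarith [hm.2]
  have hZ : njlCapZ N c m ≠ 0 := njlCapZ_ne_zero hN htop hm0 hm.1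
  have hZ₂ : njlCapZ N (c - P₂) m ≠ 0 := njlCapZ_ne_zero hN hc₁ hm0 hm.1
  rw [njlCorrelation_eq_div hL hd₁₂ hbox₁₂, njlCorrelation_eq_div hL hd₁ hbox₁R',
    njlCorrelation_eq_div hL hd₂ hbox₂]
  rw [← hc, ← hP₁, ← hP₂, plant_add', ← hP₁, ← hP₂]
  have hsub : c - (P₁ + P₂) = c - P₂ - P₁ := by rw [add_comm, tsub_tsub]
  rw [hsub]
  field_simp

end Pair

section PairAllMass

/-- **Erratum (7) ON THE WHOLE MASS REGION, uniformly in the volume — Joukowski form.**  For the NJL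
system (`N ≥ 1`, `ν ≥ 1`), multi-indices `d₁ ≤ N` supported in `{|x|_∞ + n ≤ R}` and `d₂ ≤ N`
supported in `{R < |y|_∞ ≤ R'}` (`R ≤ R'`, torus wider than `2R'`), every `r < 1` and
`0 < |w| < r`, at the mass `m = (√(2ν)/2)(w⁻¹ - w)`:
`|⟨σ^{d₁}σ^{d₂}⟩_Λ(m) - ⟨σ^{d₁}⟩_Λ(m)⟨σ^{d₂}⟩_Λ(m)| ≤ 2A(r)^{|d₁|+|d₂|} (|w|/r)^n` — exponential
clustering in the gap `n` between the supports with rate `log(r/|w|)` INDEPENDENT of `d₁, d₂`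
("`κ(m)` does not depend on `L` and `M`") and a prefactor `C(m, d₁, d₂)`. [cite: SalmhoferSeiler1992Erratum, (7)][cite: SalmhoferSeiler1991, Thm. 3.11] -/
theorem njl_pair_clustering_joukowskiMass {N : ℕ} (hN : 1 ≤ N) (hν : 1 ≤ ν) {L : ℕ} [NeZero L]
    {d₁ d₂ : Site ν →₀ ℕ} (hd₁ : ∀ x, d₁ x ≤ N) (hd₂ : ∀ x, d₂ x ≤ N) {n R R' : ℕ} (hnR : n ≤ R)
    (hRR' : R ≤ R') (hL : 2 * R' < L) (hbox₁ : ∀ x ∈ d₁.support, ∀ i, |x i| + (n : ℤ) ≤ R)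
    (hbox₂ : ∀ y ∈ d₂.support, ∀ i, |y i| ≤ (R' : ℤ)) (hfar : ∀ y ∈ d₂.support, ∃ i, (R : ℤ) < |y i|)
    {r : ℝ} (hr : r < 1) {w : ℂ} (hw0 : w ≠ 0) (hw : ‖w‖ < r) :
    ‖njlCorrelation N L (d₁ + d₂) (joukowskiMass (Real.sqrt (2 * ν)) w) -
        njlCorrelation N L d₁ (joukowskiMass (Real.sqrt (2 * ν)) w) *
          njlCorrelation N L d₂ (joukowskiMass (Real.sqrt (2 * ν)) w)‖ ≤
      2 * njlSpinMajorant ν r ^ (d₁.degree + d₂.degree) * (‖w‖ / r) ^ n := by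
  have hνpos : (0 : ℝ) < ν := by exact_mod_cast Nat.lt_of_lt_of_le Nat.zero_lt_one hν
  have hs0 : 0 < Real.sqrt (2 * (ν : ℝ)) := Real.sqrt_pos.2 (by positivity)
  set F : ℂ → ℂ := fun m => njlCorrelation N L (d₁ + d₂) m -
    njlCorrelation N L d₁ m * njlCorrelation N L d₂ m with hF
  have hFd : DifferentiableOn ℂ F {m : ℂ | m.re ≠ 0 ∨ Real.sqrt (2 * (ν : ℝ)) < ‖m‖} :=
    (differentiableOn_njlCorrelation N L _).sub
      ((differentiableOn_njlCorrelation N L _).mul (differentiableOn_njlCorrelation N L _))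
  have hO : F =O[cobounded ℂ] fun m : ℂ => (‖m‖⁻¹ ^ n : ℝ) :=
    njl_truncatedPair_isBigO hN hd₁ hd₂ hnR hRR' hL hbox₁ hbox₂ hfar
  have hdeg : (d₁ + d₂).degree = d₁.degree + d₂.degree := map_add _ _ _
  have hM : ∀ z : ℂ, z ≠ 0 → ‖z‖ < r → ‖F (joukowskiMass (Real.sqrt (2 * ν)) z)‖ ≤
      2 * njlSpinMajorant ν r ^ (d₁.degree + d₂.degree) := by
    intro z hz0 hz
    have h12 := norm_njlCorrelation_joukowskiMass_le hN hν L (d₁ + d₂) hr hz0 hz.le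
    have h1 := norm_njlCorrelation_joukowskiMass_le hN hν L d₁ hr hz0 hz.le
    have h2 := norm_njlCorrelation_joukowskiMass_le hN hν L d₂ hr hz0 hz.le
    rw [hdeg] at h12
    have hA := njlSpinMajorant_nonneg ν r
    calc ‖F (joukowskiMass (Real.sqrt (2 * ν)) z)‖
        ≤ ‖njlCorrelation N L (d₁ + d₂) (joukowskiMass (Real.sqrt (2 * ν)) z)‖ +
            ‖njlCorrelation N L d₁ (joukowskiMass (Real.sqrt (2 * ν)) z)‖ *
              ‖njlCorrelation N L d₂ (joukowskiMass (Real.sqrt (2 * ν)) z)‖ := by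
          rw [hF]; exact (norm_sub_le _ _).trans (by rw [norm_mul])
      _ ≤ njlSpinMajorant ν r ^ (d₁.degree + d₂.degree) +
            njlSpinMajorant ν r ^ d₁.degree * njlSpinMajorant ν r ^ d₂.degree := by
          gcongr
      _ = 2 * njlSpinMajorant ν r ^ (d₁.degree + d₂.degree) := by rw [pow_add]; ring
  exact norm_le_mul_pow_of_isBigO_cobounded hs0 hr.le hFd hO hM hw0 hw

/-- **Erratum (7) at every mass off `i[-√(2ν), √(2ν)]`, uniformly in the volume**: for every such
`m` there is `q(m) ∈ (0, 1)` with, for every `r ∈ (q(m), 1)`, every volume and all separated pairs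
`d₁, d₂` as above, `|⟨σ^{d₁}σ^{d₂}⟩_Λ - ⟨σ^{d₁}⟩_Λ⟨σ^{d₂}⟩_Λ|(m) ≤ 2A(r)^{|d₁|+|d₂|}(q(m)/r)^n`.
[cite: SalmhoferSeiler1992Erratum, (7)][cite: SalmhoferSeiler1991, Thm. 3.11] -/
theorem njl_pair_clustering_of_mem {N : ℕ} (hN : 1 ≤ N) (hν : 1 ≤ ν) {m : ℂ}
    (hm : m ∈ njlMassRegion ν) :
    ∃ q : ℝ, 0 < q ∧ q < 1 ∧ ∀ r : ℝ, q < r → r < 1 →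
      ∀ (L : ℕ) [NeZero L] (d₁ d₂ : Site ν →₀ ℕ), (∀ x, d₁ x ≤ N) → (∀ x, d₂ x ≤ N) →
        ∀ n R R' : ℕ, n ≤ R → R ≤ R' → 2 * R' < L →
        (∀ x ∈ d₁.support, ∀ i, |x i| + (n : ℤ) ≤ R) → (∀ y ∈ d₂.support, ∀ i, |y i| ≤ (R' : ℤ)) →
        (∀ y ∈ d₂.support, ∃ i, (R : ℤ) < |y i|) →
        ‖njlCorrelation N L (d₁ + d₂) m - njlCorrelation N L d₁ m * njlCorrelation N L d₂ m‖ ≤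
          2 * njlSpinMajorant ν r ^ (d₁.degree + d₂.degree) * (q / r) ^ n := by
  have hνpos : (0 : ℝ) < ν := by exact_mod_cast Nat.lt_of_lt_of_le Nat.zero_lt_one hν
  have hs0 : 0 < Real.sqrt (2 * (ν : ℝ)) := Real.sqrt_pos.2 (by positivity)
  obtain ⟨w, hw0, hw1, hwm⟩ := exists_joukowskiMass_eq hs0 hm
  refine ⟨‖w‖, norm_pos_iff.2 hw0, hw1, fun r hqr hr L _ d₁ d₂ hd₁ hd₂ n R R' hnR hRR' hL hbox₁
    hbox₂ hfar => ?_⟩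
  rw [← hwm]
  exact njl_pair_clustering_joukowskiMass hN hν hd₁ hd₂ hnR hRR' hL hbox₁ hbox₂ hfar hr hw0 hqr

/-- **Erratum (7), exponential form**: for every `m` off `i[-√(2ν), √(2ν)]` there is ONE rate
`κ(m) > 0` such that for all local observables `σ^{d₁}, σ^{d₂}` (`d₁, d₂ ≤ N`) there is
`C(m, d₁, d₂)` with `|⟨σ^{d₁}σ^{d₂}⟩_Λ - ⟨σ^{d₁}⟩_Λ⟨σ^{d₂}⟩_Λ|(m) ≤ C e^{-κ(m) n}` in every volume
whenever the supports are separated by a gap `n` (`d₁` in `{|x|_∞ + n ≤ R}`, `d₂` in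
`{R < |y|_∞ ≤ R'}`, torus wider than `2R'`). [cite: SalmhoferSeiler1992Erratum, (7)][cite: SalmhoferSeiler1991, Thm. 3.11] -/
theorem njl_pair_exponentialClustering {N : ℕ} (hN : 1 ≤ N) (hν : 1 ≤ ν) {m : ℂ}
    (hm : m ∈ njlMassRegion ν) :
    ∃ κ : ℝ, 0 < κ ∧ ∀ d₁ d₂ : Site ν →₀ ℕ, (∀ x, d₁ x ≤ N) → (∀ x, d₂ x ≤ N) →
      ∃ C : ℝ, 0 ≤ C ∧ ∀ (L : ℕ) [NeZero L] (n R R' : ℕ), n ≤ R → R ≤ R' → 2 * R' < L →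
        (∀ x ∈ d₁.support, ∀ i, |x i| + (n : ℤ) ≤ R) → (∀ y ∈ d₂.support, ∀ i, |y i| ≤ (R' : ℤ)) →
        (∀ y ∈ d₂.support, ∃ i, (R : ℤ) < |y i|) →
        ‖njlCorrelation N L (d₁ + d₂) m - njlCorrelation N L d₁ m * njlCorrelation N L d₂ m‖ ≤
          C * Real.exp (-κ * n) := by
  obtain ⟨q, hq0, hq1, h⟩ := njl_pair_clustering_of_mem hN hν hm
  set r : ℝ := (q + 1) / 2 with hr
  have hqr : q < r := by rw [hr]; linarith
  have hr1 : r < 1 := by rw [hr]; linarith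
  have hr0 : 0 < r := hq0.trans hqr
  refine ⟨Real.log (r / q), ?_, fun d₁ d₂ hd₁ hd₂ =>
    ⟨2 * njlSpinMajorant ν r ^ (d₁.degree + d₂.degree), by positivity [njlSpinMajorant_nonneg ν r],
      fun L _ n R R' hnR hRR' hL hbox₁ hbox₂ hfar => ?_⟩⟩
  · have : 1 < r / q := by rw [lt_div_iff₀ hq0]; linarith
    exact Real.log_pos this
  · have hexp : (q / r) ^ n = Real.exp (-Real.log (r / q) * n) := by
      have hqr' : 0 < q / r := div_pos hq0 hr0
      rw [← Real.exp_log (pow_pos hqr' n), Real.log_pow, Real.log_div hq0.ne' hr0.ne',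
        Real.log_div hr0.ne' hq0.ne']
      congr 1; ring
    rw [← hexp]
    exact h r hqr hr1 L d₁ d₂ hd₁ hd₂ n R R' hnR hRR' hL hbox₁ hbox₂ hfar

/-- **Erratum (7) for the thermodynamic limits** along every sequence of tori (Thm. 3.8): with the
same `κ(m) > 0` and `C(m, d₁, d₂)`, limits `a, b, c` of `⟨σ^{d₁}σ^{d₂}⟩_{Λ_j}`, `⟨σ^{d₁}⟩_{Λ_j}`,
`⟨σ^{d₂}⟩_{Λ_j}` at `m` satisfy `|a - bc| ≤ C e^{-κ(m) n}` whenever `d₁ ⊆ {|x|_∞ + n ≤ R}` and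
`d₂ ⊆ {R < |y|_∞}`. [cite: SalmhoferSeiler1992Erratum, (7)][cite: SalmhoferSeiler1991, Thm. 3.11] -/
theorem njl_pair_exponentialClustering_limit {N : ℕ} (hN : 1 ≤ N) (hν : 1 ≤ ν) {m : ℂ}
    (hm : m ∈ njlMassRegion ν) :
    ∃ κ : ℝ, 0 < κ ∧ ∀ d₁ d₂ : Site ν →₀ ℕ, (∀ x, d₁ x ≤ N) → (∀ x, d₂ x ≤ N) →
      ∃ C : ℝ, 0 ≤ C ∧ ∀ n R : ℕ, n ≤ R →
        (∀ x ∈ d₁.support, ∀ i, |x i| + (n : ℤ) ≤ R) → (∀ y ∈ d₂.support, ∃ i, (R : ℤ) < |y i|) →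
        ∀ (Ls : ℕ → ℕ) [∀ j, NeZero (Ls j)], Tendsto Ls atTop atTop → ∀ a b c : ℂ,
        Tendsto (fun j => njlCorrelation N (Ls j) (d₁ + d₂) m) atTop (𝓝 a) →
        Tendsto (fun j => njlCorrelation N (Ls j) d₁ m) atTop (𝓝 b) →
        Tendsto (fun j => njlCorrelation N (Ls j) d₂ m) atTop (𝓝 c) →
        ‖a - b * c‖ ≤ C * Real.exp (-κ * n) := by
  obtain ⟨κ, hκ, h⟩ := njl_pair_exponentialClustering hN hν hm
  refine ⟨κ, hκ, fun d₁ d₂ hd₁ hd₂ => ?_⟩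
  obtain ⟨C, hC0, hC⟩ := h d₁ d₂ hd₁ hd₂
  refine ⟨C, hC0, fun n R hnR hbox₁ hfar Ls _ hLs a b c ha hb hc => ?_⟩
  -- a box containing the support of `d₂` (and the box of radius `R`)
  classical
  set R' : ℕ := max R (d₂.support.sup fun y => Finset.univ.sup fun i => (y i).natAbs) with hR'
  have hRR' : R ≤ R' := le_max_left _ _
  have hbox₂ : ∀ y ∈ d₂.support, ∀ i, |y i| ≤ (R' : ℤ) := by
    intro y hy i
    have h1 : (y i).natAbs ≤ Finset.univ.sup fun j => (y j).natAbs :=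
      Finset.le_sup (f := fun j => (y j).natAbs) (Finset.mem_univ i)
    have h2 : (Finset.univ.sup fun j => (y j).natAbs) ≤
        d₂.support.sup fun y => Finset.univ.sup fun j => (y j).natAbs :=
      Finset.le_sup (f := fun y => Finset.univ.sup fun j => (y j).natAbs) hy
    have h3 : |y i| = ((y i).natAbs : ℤ) := (Int.natCast_natAbs (y i)).symm
    have hnat : (y i).natAbs ≤ R' := (h1.trans h2).trans (le_max_right _ _)
    rw [h3]
    exact_mod_cast hnat
  have hlim : Tendsto (fun j => njlCorrelation N (Ls j) (d₁ + d₂) m -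
      njlCorrelation N (Ls j) d₁ m * njlCorrelation N (Ls j) d₂ m) atTop (𝓝 (a - b * c)) :=
    ha.sub (hb.mul hc)
  refine le_of_tendsto ((continuous_norm.tendsto _).comp hlim) ?_
  filter_upwards [hLs.eventually_gt_atTop (2 * R')] with j hj
  exact hC (Ls j) n R R' hnR hRR' hj hbox₁ hbox₂ hfar

end PairAllMass

end ComplexSpin

end Literature.MathematicalPhysics.StatisticalMechanics
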